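import Mathlib
import Summits.KontsevichZagierPeriods.Zeta5Search.WedgeDictionaryData3
import Summits.KontsevichZagierPeriods.Zeta5Search.WedgeDictionaryAnchor
import Summits.KontsevichZagierPeriods.Zeta5Search.WedgeDictionaryAnchor1Id
import Summits.KontsevichZagierPeriods.Zeta5Search.WedgeDictionaryAnchor2
import HarnessLib

/-!
# gen-1's wedge dictionary is EQUIVALENT to its two DIAGONAL instances `n = 1, 2` and ONE level-1 value;
# given Brown–Zudilin's printed `I₁, I₂` it is ONE number (cell `pub-zeta5`, seat ct-1 g19)

HONEST FRAMING: systematic search; no irrationality claim unless certified.  Equivalences between DISPLAYED statements about gen-1's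
period dictionary (`WedgeDictionary.explicitPQ` / `wedgeDictionary`, OPEN `@[conjecture]` nodes) and some of its instances; the only
analytic inputs are tree theorems (the STAR / PENCIL / BRIDGE families, the invariance (27)) and, in §4–§5, the named Literature fact
`BrownZudilin2022.I_init` EXACTLY as typed (the printed values `I₁`, `I₂` of arXiv:2210.03391, Sect. 2, eq. (5); a HyperInt computation in the
source).  No integral is evaluated here, no linear form is bounded, nothing about ζ(5), no `γ`, no denominator statement.

OUR work (Summit side).  ct-1 g18's end statement `WedgeDictionaryData3.explicitPQ_iff_data3 : explicitPQ ↔ D1 ∧ D2 ∧ D17` (three level-1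
values: the axis point `(1,0,1,0,1,1,1,1; 1)`, the single-slot point `(0,0,1,0,1,1,1,1; 2)`, the top-pair point `(0,0,1,0,1,1,0,1; 2)`) combined
with gen-1 g17's two EXACT diagonal-anchoring certificates (memo `pub-zeta5-gen-1/D2-TERMINAL-g17.md` §5b), rendered in identity form by this seat
(`WedgeDictionaryAnchor1Id`, 54 relation instances; `WedgeDictionaryAnchor2`, 175 relation instances — the `n = 2` certificate
`code/gen1/g17/data/anchor_n2_cone6_noT.json` had never been filed):
  `δ(1⁸) = −12·δ₁ + 9·δ₂ − 2·δ₁₇`,   `δ(2⁸) = −(13757/8)·δ₁ + (10155/8)·δ₂ − (18063/64)·δ₁₇`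
(`δ` = `CertKit.defect`, the defect of `explicitPQ` at a point; `δ₁, δ₂, δ₁₇` at the three level-1 points), whose `(δ₁, δ₂)`-block has determinant
`1953/8 ≠ 0`:

* §1 `anchor1`, `anchor2` — the two identities HYPOTHESIS-FREE (families discharged by `cellStar_holds`, `dictStar_holds`, `cellPencil_holds`,
  `dictPencil_holds`, `cellBridge_holds`, `dictBridge_holds`);
* §2 `D1_D2_of_diag2_top` — `ExplicitPQAt` at `1⁸`, `2⁸` (partner 1) and at the top-pair point give `D1` and `D2` (Cramer, two `linear_combination`s);
* §3 **`explicitPQ_iff_diag2_top : explicitPQ ↔ ExplicitPQAt 1⁸ 1 ∧ ExplicitPQAt 2⁸ 1 ∧ ExplicitPQAt (0,0,1,0,1,1,0,1) 2`** (hypothesis-free) and the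
  same for `wedgeDictionary`: the dictionary conjecture is equivalent to its two smallest DIAGONAL instances plus ONE level-1 value;
* §4 `explicitPQAt_diag_one_of_I_init`, `explicitPQAt_diag_two_of_I_init` — the two diagonal instances from `I_init` ALONE (its `n = 1, 2` clauses and
  the tree's `bz_Q_ray` / `bz_Phat_ray` / `bz_P_ray`: Brown–Zudilin's `Q_n, P̂_n, P_n` ARE the dictionary minors on the diagonal); the recursion
  `I_solvesRec` used by `SymRay.explicitPQ_diag` / `WedgeDictionaryAnchor` is NOT needed for `n ≤ 2`;
* §5 **`explicitPQ_iff_top_of_I_init : I_init → (explicitPQ ↔ ExplicitPQAt (0,0,1,0,1,1,0,1) 2)`** and `wedgeDictionary_iff_top_of_I_init`: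
  GIVEN Brown–Zudilin's printed `I₁, I₂`, gen-1's wedge dictionary (every admissible `a`) is EQUIVALENT to ONE identity
  `I(0,0,1,0,1,1,0,1) ∈ ℚ·(2ζ(5)+4ζ(3)ζ(2)) + ℚ·ζ(2) + ℚ` (explicit rationals) for ONE 5-fold cellular integral at level `b₀ = 1`.

What this file is NOT: a proof of that value (a period computation), of `I_init`, of `explicitPQ`, or of anything about irrationality.
-/

noncomputable section

open Finset

namespace Summit.KontsevichZagierPeriods.Zeta5Search.WedgeDictionaryDiagData

open Summit.KontsevichZagierPeriods.Zeta5Search.WedgeDictionary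
open Summit.KontsevichZagierPeriods.Zeta5Search.WedgeDictionary.CertKit (defect defect_of_at at_of_defect)
open Summit.KontsevichZagierPeriods.Zeta5Search.DualSeries
open Summit.KontsevichZagierPeriods.Zeta5Search.SymRay
open Summit.KontsevichZagierPeriods.Zeta5Search.CellStarPencilDischarge (cellStar_holds cellPencil_holds)
open Summit.KontsevichZagierPeriods.Zeta5Search.CellBridgeDischarge (cellBridge_holds)
open Summit.KontsevichZagierPeriods.Zeta5Search.Elimination (dictStar_holds dictPencil_holds dictBridge_holds)
open Summit.KontsevichZagierPeriods.Zeta5Search.WedgeDictionaryData3 (explicitPQ_of_data3 explicitPQ_iff_data3)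
open Literature.NumberTheory.Irrationality
open Literature.NumberTheory.Irrationality.BrownZudilin2022 (I_init Isym zeta5hat Qsol Phat P bOfA cellularIntegral QOf)
open Literature.NumberTheory.Transcendental (zetaValue)

/-! ## 1. The two anchoring identities, hypothesis-free -/

/-- **Anchoring row `n = 1`** (gen-1 g17, 54 relation instances, `WedgeDictionaryAnchor1Id`), families discharged:
`δ(1⁸) + 12·δ₁ − 9·δ₂ + 2·δ₁₇ = 0`. -/
theorem anchor1 :
    (1 : ℝ) * defect ![1,1,1,1,1,1,1,1] 1 + (12 : ℝ) * defect ![1,0,1,0,1,1,1,1] 1 + (-9 : ℝ) * defect ![0,0,1,0,1,1,1,1] 2 +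
      (2 : ℝ) * defect ![0,0,1,0,1,1,0,1] 2 = 0 :=
  Anchor1Id.identity cellStar_holds dictStar_holds cellPencil_holds dictPencil_holds cellBridge_holds dictBridge_holds

/-- **Anchoring row `n = 2`** (gen-1 g17, 175 relation instances, `WedgeDictionaryAnchor2`), families discharged:
`δ(2⁸) + (13757/8)·δ₁ − (10155/8)·δ₂ + (18063/64)·δ₁₇ = 0`. -/
theorem anchor2 :
    (1 : ℝ) * defect ![2,2,2,2,2,2,2,2] 1 + (13757 / 8 : ℝ) * defect ![1,0,1,0,1,1,1,1] 1 + (-10155 / 8 : ℝ) * defect ![0,0,1,0,1,1,1,1] 2 +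
      (18063 / 64 : ℝ) * defect ![0,0,1,0,1,1,0,1] 2 = 0 :=
  Anchor2.identity cellStar_holds dictStar_holds cellPencil_holds dictPencil_holds cellBridge_holds dictBridge_holds

/-! ## 2. `D1` and `D2` from the two diagonal values and the top-pair value -/

/-- **Cramer step.**  `ExplicitPQAt` at the diagonal points `1⁸`, `2⁸` (partner `1`) and at the top-pair point `(0,0,1,0,1,1,0,1)` (partner `2`)
give `ExplicitPQAt` at the axis point `(1,0,1,0,1,1,1,1)` and at the single-slot point `(0,0,1,0,1,1,1,1)`: the `(δ₁, δ₂)`-block of the two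
anchoring rows has determinant `(−12)(10155/8) − 9·(−13757/8) = 1953/8 ≠ 0`. -/
theorem D1_D2_of_diag2_top (K1 : ExplicitPQAt ![1,1,1,1,1,1,1,1] 1) (K2 : ExplicitPQAt ![2,2,2,2,2,2,2,2] 1)
    (D17 : ExplicitPQAt ![0,0,1,0,1,1,0,1] 2) :
    ExplicitPQAt ![1,0,1,0,1,1,1,1] 1 ∧ ExplicitPQAt ![0,0,1,0,1,1,1,1] 2 := by
  have h1 := anchor1
  have h2 := anchor2
  have e1 := defect_of_at K1
  have e2 := defect_of_at K2
  have e17 := defect_of_at D17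
  refine ⟨at_of_defect ?_, at_of_defect ?_⟩
  · linear_combination (-3385 / 651 : ℝ) * h1 + (8 / 217 : ℝ) * h2 + (3385 / 651 : ℝ) * e1 + (-8 / 217 : ℝ) * e2 +
      (-29 / 5208 : ℝ) * e17
  · linear_combination (-13757 / 1953 : ℝ) * h1 + (32 / 651 : ℝ) * h2 + (13757 / 1953 : ℝ) * e1 + (-32 / 651 : ℝ) * e2 +
      (839 / 3906 : ℝ) * e17

/-! ## 3. `explicitPQ` ⟺ two diagonal instances and one level-1 value (hypothesis-free) -/

/-- **gen-1's wedge conjecture `explicitPQ` is EQUIVALENT to its instances at `a = 1⁸`, `a = 2⁸` (partner `1`) and at the level-1 top-pair point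
`(0,0,1,0,1,1,0,1)` (partner `2`)** — hypothesis-free (STAR, PENCIL, BRIDGE, both dictionary nodes, the invariance (27), `D16` and now `D1`, `D2`
all discharged by tree theorems). -/
theorem explicitPQ_iff_diag2_top :
    explicitPQ ↔
      (ExplicitPQAt ![1,1,1,1,1,1,1,1] 1 ∧ ExplicitPQAt ![2,2,2,2,2,2,2,2] 1 ∧ ExplicitPQAt ![0,0,1,0,1,1,0,1] 2) := by
  refine ⟨fun h => ⟨explicitPQ_iff_at.1 h _ _ (by unfold RegionHyp; decide), explicitPQ_iff_at.1 h _ _ (by unfold RegionHyp; decide),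
    (explicitPQ_iff_data3.1 h).2.2⟩, fun h => ?_⟩
  obtain ⟨D1, D2⟩ := D1_D2_of_diag2_top h.1 h.2.1 h.2.2
  exact explicitPQ_of_data3 D1 D2 h.2.2

/-- **The same for the wedge-square dictionary** `WedgeDictionary.wedgeDictionary`. -/
theorem wedgeDictionary_iff_diag2_top :
    wedgeDictionary ↔
      (ExplicitPQAt ![1,1,1,1,1,1,1,1] 1 ∧ ExplicitPQAt ![2,2,2,2,2,2,2,2] 1 ∧ ExplicitPQAt ![0,0,1,0,1,1,0,1] 2) :=
  wedgeDictionary_iff_explicitPQ.trans explicitPQ_iff_diag2_top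

/-! ## 4. The two diagonal instances from Brown–Zudilin's printed `I₁`, `I₂` (`I_init`), without the recursion -/

/-- **The dictionary identity at `a = n·1⁸` (partner `1`) from the decomposition (5) AT THAT `n` ALONE**: if
`I_n = Q_nθ − 4P̂_nζ(2) − 2P_n` with Brown–Zudilin's `Q_n, P̂_n, P_n` (the recursion solutions `Qsol, Phat, P` with the printed initial data), then
`ExplicitPQAt (n·1⁸) 1` — because `Q_n, P̂_n, P_n` ARE the three dictionary minors on the diagonal (`bz_Q_ray`, `bz_Phat_ray`, `bz_P_ray`, all `n`).
This is `SymRay.explicitPQ_diag` with its use of `symmetricDecomposition` (hence of `I_solvesRec`) replaced by the hypothesis at one `n`. -/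
theorem explicitPQAt_aDiag_of_eq {n : ℕ}
    (hI : Isym n = (Qsol n : ℝ) * zeta5hat - 4 * (Phat n : ℝ) * zetaValue 2 - 2 * (P n : ℝ)) : ExplicitPQAt (aDiag n) 1 := by
  have hmin : cellularIntegral (aDiag n) =
      ((-1) ^ n * (n.factorial : ℝ) ^ 10 / (4 * ((2 * n).factorial : ℝ))) *
        (((coeffU (bRay n) : ℝ) * coeffW (bRay' n) - coeffU (bRay' n) * coeffW (bRay n)) *
            (2 * zetaValue 5 + 4 * zetaValue 3 * zetaValue 2) -
          4 * ((coeffU (bRay n) : ℝ) * coeffV (bRay' n) - coeffU (bRay' n) * coeffV (bRay n)) * zetaValue 2 -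
          2 * ((coeffV (bRay n) : ℝ) * coeffW (bRay' n) - coeffV (bRay' n) * coeffW (bRay n))) := by
    rw [cellularIntegral_aDiag, hI, zeta5hat, ← SymmetricRecursion.Q_eq_Qsol n, bz_Phat_ray, bz_P_ray]
    have hQ := congrArg (fun q : ℚ => (q : ℝ)) (bz_Q_ray n)
    push_cast at hQ ⊢
    linear_combination (2 * zetaValue 5 + 4 * zetaValue 3 * zetaValue 2) * hQ
  unfold ExplicitPQAt dictPhat dictP
  rw [update_bOfA_diag, bOfA_diag, QOf_diag, rhoOf_diag, hmin]
  have hQ := congrArg (fun q : ℚ => (q : ℝ)) (bz_Q_ray n)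
  push_cast at hQ ⊢
  linear_combination (-(2 * zetaValue 5 + 4 * zetaValue 3 * zetaValue 2)) * hQ

/-- `a = 2·1⁸` as a vector literal. -/
theorem aDiag_two : aDiag 2 = ![2,2,2,2,2,2,2,2] := by
  ext i; fin_cases i <;> rfl

/-- **`ExplicitPQAt 1⁸ 1` from `I_init`** (its `n = 1` clause `I₁ = 21θ − 4·(101/4)ζ(2) − 2·(87/4)`; no recursion). -/
theorem explicitPQAt_diag_one_of_I_init (h : I_init) : ExplicitPQAt ![1,1,1,1,1,1,1,1] 1 := by
  rw [← aDiag_one]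
  exact explicitPQAt_aDiag_of_eq (by rw [h.2.1]; simp [Qsol, Phat, P])

/-- **`ExplicitPQAt 2⁸ 1` from `I_init`** (its `n = 2` clause `I₂ = 2989θ − 4·(344923/96)ζ(2) − 2·(1190161/384)`; no recursion). -/
theorem explicitPQAt_diag_two_of_I_init (h : I_init) : ExplicitPQAt ![2,2,2,2,2,2,2,2] 1 := by
  rw [← aDiag_two]
  exact explicitPQAt_aDiag_of_eq (by rw [h.2.2]; simp [Qsol, Phat, P])

/-! ## 5. Given `I_init`, the wedge dictionary is ONE number -/

/-- **Given Brown–Zudilin's printed `I₁, I₂` (`I_init`), gen-1's wedge conjecture `explicitPQ` (every admissible `a`) is EQUIVALENT to ONE of its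
level-1 instances**: `ExplicitPQAt (0,0,1,0,1,1,0,1) 2`, i.e. the single identity
`I(0,0,1,0,1,1,0,1) = Q·(2ζ(5)+4ζ(3)ζ(2)) − 4P̂_d·ζ(2) − 2P_d` with the dictionary's explicit rationals for ONE 5-fold cellular integral. -/
theorem explicitPQ_iff_top_of_I_init (h : I_init) : explicitPQ ↔ ExplicitPQAt ![0,0,1,0,1,1,0,1] 2 :=
  ⟨fun hx => (explicitPQ_iff_diag2_top.1 hx).2.2,
    fun D17 => explicitPQ_iff_diag2_top.2 ⟨explicitPQAt_diag_one_of_I_init h, explicitPQAt_diag_two_of_I_init h, D17⟩⟩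

/-- **The same for the wedge-square dictionary**: given `I_init`, `wedgeDictionary ↔ ExplicitPQAt (0,0,1,0,1,1,0,1) 2`. -/
theorem wedgeDictionary_iff_top_of_I_init (h : I_init) : wedgeDictionary ↔ ExplicitPQAt ![0,0,1,0,1,1,0,1] 2 :=
  wedgeDictionary_iff_explicitPQ.trans (explicitPQ_iff_top_of_I_init h)

/-- Implication form: `I_init` and the top-pair value give `explicitPQ`. -/
theorem explicitPQ_of_I_init_top (h : I_init) (D17 : ExplicitPQAt ![0,0,1,0,1,1,0,1] 2) : explicitPQ :=
  (explicitPQ_iff_top_of_I_init h).2 D17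

end Summit.KontsevichZagierPeriods.Zeta5Search.WedgeDictionaryDiagData

end
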